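import Summits.HodgeConjecture.HodgeCM.Model.Binders.Gen12Junctions_1

/-! PORT of `HodgeCM/Model/Binders/Gen12Junctions.lean` (HodgeCMPerL run 82) — part 2: continuation of `Summits.HodgeConjecture.HodgeCM.Model.Binders.Gen12Junctions_1` (split at a top-level declaration boundary by port_pkg.py; scope re-opened below; declarations unchanged). -/

-- port_pkg: scope re-opened for this part (file-level context, then the namespace/section stack open at the cut)
set_option autoImplicit false
noncomputable section
open scoped InnerProductSpace
open MeasureTheory
namespace HodgeCM
namespace Model
open HodgeCM.Universe (AdelicThetaCore AdelicThetaCore₀ SideData ThetaModel)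
open Literature.AlgebraicGeometry.HodgeTheory
open Literature.NumberTheory.Automorphic.PicardCM
open Literature.NumberTheory.Transcendental (Arapura2012_Cor_15_4_6)
open Literature.NumberTheory.Automorphic Literature.NumberTheory.Weil1964
open Literature.NumberTheory.Automorphic.WeightForms (ClassMapDatum thetaClasses restrictHom IsLevelCorrected IsWeightMatched)
open HodgeCM.Model.ThetaSpace
open NumberField
variable (hHD : exists_isReal_hodgeModel) (hI : hodgePQ_independent_of_hodgeModel)
  (h₁ : BallQuotientUniformised)  (h₃ : CMAbelianVarietyRealised)
variable (h : Bool) (hA : Arapura2012_Cor_15_4_6)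
  (W : ∀ {L : CMField} {ι₁ : L →+* ℂ} (V : HermSpace3 L ι₁) (c : SeesawCtx L), WmInput V c.D)
  (S : ∀ {L : CMField} {ι₁ : L →+* ℂ} (V : HermSpace3 L ι₁) (c : SeesawCtx L), ThetaAdelicSide V c)
  (μ : ∀ {L : CMField}, SeesawCtx L → Fin 4 → InfinitePlace L → ℤ)
variable {L : CMField} {ι₁ : L →+* ℂ} (V : HermSpace3 L ι₁) (c : SeesawCtx L) (hV : IsAnisotropic L V.Hm)
namespace Gen12Junctions
variable {hHD hI h₁ h₃ h hA W S μ V c hV}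
variable (J : Gen12Junctions hHD hI h₁ h₃ h hA W S μ V c hV)
/-- **E's binder `gen12` at `(V, c)` from the junction hypotheses** (`Nonempty (… Gen12FunBridge V c)`; the character index and
the Schwartz index needed by the choice are `SeesawTorus.nonempty_allowedChars` and `0 ∈ 𝒮^κ`). -/
theorem nonempty_gen12FunBridge (J : Gen12Junctions hHD hI h₁ h₃ h hA W S μ V c hV) :
    Nonempty ((pinT hHD hI h₁ h₃ h hA W S μ).Gen12FunBridge V c) :=
  (pinT hHD hI h₁ h₃ h hA W S μ).nonempty_gen12FunBridge_of_spanBridge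
    (Classical.choice (NumberField.SeesawTorus.nonempty_allowedChars (L := (L : Type)) (d12Of μ c).m₁ (d12Of μ c).m₂))
    (⟨0, (W V c).SK_zero⟩ : ↥(W V c).SK) J.spanBridge

end Gen12Junctions

/-- **E's binder `gen12` IN ITS QUANTIFIED FORM from junction hypotheses at every good sextic context** (the regime `hV` is forced by
the context: `isAnisotropic_of_goodCtx`). -/
theorem gen12_of_junctions
    (J : ∀ {L : CMField} {ι₁ : L →+* ℂ} (V : HermSpace3 L ι₁) (c : SeesawCtx L) (hV : IsAnisotropic L V.Hm),
      (pinT hHD hI h₁ h₃ h hA W S μ).GoodCtx ι₁ c → Module.finrank ℚ c.K = 6 →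
        Gen12Junctions hHD hI h₁ h₃ h hA W S μ V c hV)
    {L : CMField} {ι₁ : L →+* ℂ} (V : HermSpace3 L ι₁) (c : SeesawCtx L)
    (hc : (pinT hHD hI h₁ h₃ h hA W S μ).GoodCtx ι₁ c) (hK : Module.finrank ℚ c.K = 6) :
    Nonempty ((pinT hHD hI h₁ h₃ h hA W S μ).Gen12FunBridge V c) :=
  (J V c (isAnisotropic_of_goodCtx V hc hK) hc hK).nonempty_gen12FunBridge

end Model

end HodgeCM

end
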